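import Mathlib
import HarnessLib
import Summits.QuantumFields.YangMills.Theses.FemtoCutoffLadder
import Summits.QuantumFields.YangMills.Theorems.FemtoCutoffLadderMatchedCouplingExists
import Summits.QuantumFields.YangMills.Theorems.FemtoTransferGapBounds
import Summits.QuantumFields.YangMills.Theorems.FemtoTransferGapLevelsPos

/-!
# Route `FemtoCutoffLadder` — the TWO-TOWERS composition for `EventualTowerDominancePw` (stmt-QuantumFields-25890)

Lead seat `ym-line-fcl-p1` g9 (2026-08-28), landing the planner's (ym-idea-1 g4, Sketch6) kernel-checked composition against the rev-16/17
route decl: SELF-TOWER-FREQUENTLY (the lower tower comparison of `OctaveStepDecay` re-widened to EVERY base, but only at SOME large heights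
and rate-free) and CROSS-TOWER AGREEMENT (one-sided universality of the VALUE of the femto gap across regularisation towers at infinite
height — the non-uniqueness clause of the barrier `UVStabilityNonUniqueness` itself) imply the pointwise eventual tower dominance
`EventualTowerDominancePw` BY NAME.  Both hypotheses are spelled out (they are the two stubs of the registered skeleton «two-towers» on
25890, `Cruxes/SubOctaveBounded/Lines/dyadic_eventual_twotowers.lean`); neither is proved here.
HONEST FRAMING: real arithmetic + `ε/2`; R2b1 is a RECORD rung — not infinite volume, not a mass gap, not Clay; no summit is proved by
this line.  No definitions, no named facts, no `sorry`.
-/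

set_option autoImplicit false

namespace Summit.QuantumFields.YangMills.Theorems.FemtoCutoffLadder

open Summit.QuantumFields.YangMills.Theorems.FemtoTransferGap
open Summit.QuantumFields.YangMills.Theses.FemtoCutoffLadder

/-- ★ **Two towers ⟹ pointwise eventual tower dominance.**  (hS) SELF-TOWER, FREQUENTLY: for every base `L' ≥ L₀`, window coupling
`β'`, `ε > 0` and `j₀` there is a height `j ≥ j₀` with `z(Λ, L'·2^j) ≥ z(Λ, L') − CΛ² − ε` (lower direction along the own tower,
rate-free); (hX) CROSS-TOWER AGREEMENT: for incommensurable `L₀ ≤ L' ≤ L < 2L'` and `ε > 0`, eventually in the height `j` of the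
`L'`-tower, every window coupling there is ε-dominated by SOME member of the `L`-tower (one-sided universality of the femto-gap value
across towers).  Then `EventualTowerDominancePw` (stmt-QuantumFields-25890) BY NAME, with the constant of (hS): pass through the
height-`j` member of the `L'`-tower (matched coupling from `matchedCouplingExists_proof`, levels `≤ 1/2`), multiply, cancel.
Planner ym-idea-1 g4's Sketch6 composition (evidence `line-two-towers-pw.lean` on 25890), hypotheses spelled out.
[cite: LuscherWeiszWolff1991] [cite: Symanzik1983] -/
theorem eventualTowerDominancePw_of_selfTower_of_crossTower
    (hS : ∃ (C lam0 : ℝ) (L0 : ℕ), 0 < lam0 ∧ ∀ lam : ℝ, 0 < lam → lam ≤ lam0 → ∀ (L' : ℕ) [NeZero L'], L0 ≤ L' →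
          ∀ β' : ℝ, InFemtoWindow lam β' L' → ∀ ε : ℝ, 0 < ε → ∀ j0 : ℕ, ∃ j : ℕ, j0 ≤ j ∧ ∀ (N : ℕ) [NeZero N], N = L' * 2 ^ j →
            ∀ βN : ℝ, InFemtoWindow lam βN N → luscherLambda βN N = luscherLambda β' L' →
              secondValue su2Rep N βN ^ N * topValue su2Rep L' β' ^ L' ≤
                Real.exp (C * luscherLambda βN N ^ 2 + ε) * (secondValue su2Rep L' β' ^ L' * topValue su2Rep N βN ^ N))
    (hX : ∃ (lam0 : ℝ) (L0 : ℕ), 0 < lam0 ∧ ∀ lam : ℝ, 0 < lam → lam ≤ lam0 → ∀ (L' : ℕ) [NeZero L'] (L : ℕ) [NeZero L],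
          L0 ≤ L' → L' ≤ L → L < 2 * L' → ∀ ε : ℝ, 0 < ε → ∃ j0 : ℕ, ∀ j : ℕ, j0 ≤ j → ∀ (N : ℕ) [NeZero N], N = L' * 2 ^ j →
            ∀ βN : ℝ, InFemtoWindow lam βN N → ∃ k : ℕ, ∀ (M : ℕ) [NeZero M], M = L * 2 ^ k → ∀ βM : ℝ,
              InFemtoWindow lam βM M → luscherLambda βM M = luscherLambda βN N →
                secondValue su2Rep M βM ^ M * topValue su2Rep N βN ^ N ≤
                  Real.exp ε * (secondValue su2Rep N βN ^ N * topValue su2Rep M βM ^ M)) :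
    EventualTowerDominancePw := by
  obtain ⟨C, lamS, L0S, hlamS, HS⟩ := hS
  obtain ⟨lamX, L0X, hlamX, HX⟩ := hX
  have hMCE : MatchedCouplingExists := matchedCouplingExists_proof
  refine ⟨C, min (min lamS lamX) (1 / 2), max L0S L0X, lt_min (lt_min hlamS hlamX) (by norm_num), ?_⟩
  intro lam hlam hle L' _ L _ hL0 hL'L hL2 β' hW' ε hε
  have hleS : lam ≤ lamS := hle.trans ((min_le_left _ _).trans (min_le_left _ _))
  have hleX : lam ≤ lamX := hle.trans ((min_le_left _ _).trans (min_le_right _ _))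
  have hhalf : lam ≤ 1 / 2 := hle.trans (min_le_right _ _)
  have hL0S : L0S ≤ L' := (le_max_left _ _).trans hL0
  have hL0X : L0X ≤ L' := (le_max_right _ _).trans hL0
  have hε2 : 0 < ε / 2 := by linarith
  obtain ⟨j0, HXj⟩ := HX lam hlam hleX L' L hL0X hL'L hL2 (ε / 2) hε2
  obtain ⟨j, hj0, HSj⟩ := HS lam hlam hleS L' hL0S β' hW' (ε / 2) hε2 j0
  haveI : NeZero (L' * 2 ^ j) := ⟨mul_ne_zero (NeZero.ne L') (pow_ne_zero _ two_ne_zero)⟩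
  obtain ⟨βN, hWN, hΛN⟩ := hMCE lam hlam hhalf L' (L' * 2 ^ j) β' hW'
  obtain ⟨k, HXk⟩ := HXj j hj0 (L' * 2 ^ j) rfl βN hWN
  refine ⟨k, ?_⟩
  intro M _ hM βM hWM hΛ
  have h1 := HXk M hM βM hWM (hΛ.trans hΛN.symm)
  have h2 := HSj (L' * 2 ^ j) rfl βN hWN hΛN
  set SM := secondValue su2Rep M βM ^ M
  set TM := topValue su2Rep M βM ^ M
  set SN := secondValue su2Rep (L' * 2 ^ j) βN ^ (L' * 2 ^ j)
  set TN := topValue su2Rep (L' * 2 ^ j) βN ^ (L' * 2 ^ j)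
  set S' := secondValue su2Rep L' β' ^ L'
  set T' := topValue su2Rep L' β' ^ L'
  have hSN : 0 < SN := pow_pos (secondValue_su2Rep_pos (lt_of_lt_of_le one_pos hWN.1)) _
  have hTN : 0 < TN := pow_pos (topValue_su2Rep_pos _ _) _
  have hT' : 0 ≤ T' := pow_nonneg (topValue_su2Rep_pos _ _).le _
  have hTM : 0 ≤ TM := pow_nonneg (topValue_su2Rep_pos _ _).le _
  rw [hΛN, ← hΛ] at h2
  have key : SM * T' * (SN * TN) ≤ Real.exp (C * luscherLambda βM M ^ 2 + ε) * (S' * TM) * (SN * TN) := by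
    have c1 : SM * T' * (SN * TN) ≤ Real.exp (ε / 2) * (SN * TM) * T' * SN := by
      have := mul_le_mul_of_nonneg_right (mul_le_mul_of_nonneg_right h1 hT') hSN.le
      calc SM * T' * (SN * TN) = SM * TN * T' * SN := by ring
        _ ≤ _ := this
    have c2 : Real.exp (ε / 2) * (SN * TM) * T' * SN ≤
        Real.exp (ε / 2) * TM * SN * (Real.exp (C * luscherLambda βM M ^ 2 + ε / 2) * (S' * TN)) := by
      have hc : 0 ≤ Real.exp (ε / 2) * TM * SN := mul_nonneg (mul_nonneg (Real.exp_pos _).le hTM) hSN.le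
      have := mul_le_mul_of_nonneg_left h2 hc
      calc Real.exp (ε / 2) * (SN * TM) * T' * SN = Real.exp (ε / 2) * TM * SN * (SN * T') := by ring
        _ ≤ _ := this
    calc SM * T' * (SN * TN) ≤ _ := c1
      _ ≤ _ := c2
      _ = Real.exp (C * luscherLambda βM M ^ 2 + ε) * (S' * TM) * (SN * TN) := by
          have : Real.exp (C * luscherLambda βM M ^ 2 + ε) =
              Real.exp (ε / 2) * Real.exp (C * luscherLambda βM M ^ 2 + ε / 2) := by
            rw [← Real.exp_add]; ring_nf
          rw [this]; ring
  exact le_of_mul_le_mul_right key (mul_pos hSN hTN)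


end Summit.QuantumFields.YangMills.Theorems.FemtoCutoffLadder
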